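import Summits.HodgeConjecture.HodgeConjecture.Theorems.R90S9SgTailOfAeOfXiLocalFamily     -- ★ p862121 (this seat): `routesAt_of_ae` ((AE) routes `P` by `ξ` off a finite set; brings ★ `RoutesAt`, ★ S5 `R90S5EvpOfAeRouting`)
import Summits.HodgeConjecture.HodgeConjecture.Theorems.R90S9InnerFormSec146Packets        -- ★ p862341 (R90-IF-p01, (D) ED. 2′): `TransportsToSphAt`, `evpFin`, `evp`, `evpRepOf`, `evpRep`, `piXiPrime`, `evp_piXiPrime_iff`, `evpRep_classOf`
import Summits.HodgeConjecture.HodgeConjecture.Theorems.F0P3XiEvpOfRecordSCDSigned          -- ★ p843355: the SCD record `xiPacketFamilyOfRecordSCD` (`_of_split`, `_of_nonsplit`) + the SIGNED partner datum `hSCD_of_cmCharIdentityPackageTestSigned` (+ `_fst` pin)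
import Literature.NumberTheory.Automorphic.LocalUnitaryIntegralLevelCongr                 -- ★ `eventually_exists_cmDatumLocalCongr_levelMatching_three` (cofinitely many places admit a level-matching frame)
import HarnessLib

/-!
# R90-TF · S9 «InnerForm-13.3.6 (c)» — (α) PART 2: `t(P) = t(Π(ξ))` AT THE DATUM — THE ENGINE'S `hevp` PIN READ AT R90-IF-p01's (D) FROM (AE) AND «t(Π′(ξ)) = t(Π(ξ))»
# (Rogawski 1990, §14.6 p. 242 ll. 6–8 (e.v.p.), Thm. 14.6.4 p. 244; §13.1 p. 199; §13.7 p. 206; §14.2 p. 233)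

Cell `hodgecm-mathlib`, crux H413 (`stmt-HodgeConjecture-24833`, lane `--supports … --as helper`), route of record `HCCMUnconditional` (no route verbs; count-neutral).
Programme R90-TF (brief `director/R90-BRIEF.v2.md` 1f40d54518340a35), section S9 = InnerForm-13.3.6 (c) (base `R90-IF`); seat R90-IF-p06 (g0); deal (α)
`definiteAeRigidity_ofDatum` (R90-IF-plan (g0) DEAL MAP 16:51:37Z (4), S9-R-CMP v2 22:00:32Z (e)).  THEOREMS ONLY (no `def`, no instance, no notation, no named-fact
hypothesis, no `sorry`).
HONEST LABEL: HC_CM is proved only modulo the 7 printed citations (2 remaining named inputs: hLiu418 = stmt-HodgeConjecture-24832, h413 = stmt-HodgeConjecture-24833) —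
until rung 0 closes.  Datum book-keeping (filters + ★ routing); no leaf moves; REL ≠ ★ ≠ BUILT.

WHAT.  The (AE-ⅱ) engine ★ `definiteAeRigidityAt_of_parts` (p861961) takes the pin `hevp : ‹E1 string› → Γ.evpRep π′ Pξ` («`t(π′) = t(Π(ξ))`», p. 242).  At R90-IF-p01's datum
(★ (D) `R90S9InnerFormSec146Packets`: `Γ₀.evpRep [P] Pg := evpRepOf L H μA 𝔩 P Pg` = «for almost all `v`, the chosen class ★ `clFinChoice P v` transports to the unramified
member `sph (Pg.loc v)` along every level-matching frame» (`TransportsToSphAt`), `Γ₀.evp (Π′(ξ)) Pg := evpFin L H 𝔩 (Ξ ξ) Pg`, ★ `evp_piXiPrime_iff`, ★ `evpRep_classOf`), with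
`Ξ` the A-packet family of record ★ `xiPacketFamilyOfRecordSCD … μZ keys hSC`, the pin is discharged DIRECTLY FROM (AE) (the E1 string of ★ `aeString_of_ae` is then
ignored: `hevp := fun _ => …`) modulo the ONE G-side input «`t(Π′(ξ)) = t(Π(ξ))`» — `Γ₀.evp (Γ₀.PiXi′ ξ …) Pξ`, i.e. `evpFin L H 𝔩 (Ξ ξ) Pξ`: the unramified member of the
G-packet `Π(ξ)` OF RECORD at the quasi-split kit is the transported `πⁿ(ξ_v) ∘ e` a.e. (an S5 statement about S5's packet of record; junction input `hevpXi` of (α)):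
(AE) ROUTES `P` by `ξ` off a finite set (★ `routesAt_of_ae`: split `v` — the singleton split packet; non-split `v` — Keys' `πⁿ` along every level-matching frame), the
record at `v` IS that split packet ∕ `⟨πⁿ ∘ e₀, some πˢ⟩` at a frame `e₀` which is level-matching whenever a level-matching frame exists (★ `xiPacketFamilyOfRecordSCD_of_split`
∕ `_of_nonsplit`), and cofinitely many places admit one (★ `eventually_exists_cmDatumLocalCongr_levelMatching_three`, §14.2 p. 233) — so `clFinChoice P v = (Ξ ξ v).πn`
for almost all `v` (§1), whence `evpFin (Ξ ξ) Pg → evpRepOf P Pg` (§2, a filter triviality).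
* §1 `eventually_clFinChoice_eq_πn_recordSCD_of_routesAt` — routed off a finite set ⟹ `∀ᶠ v in cofinite, clFinChoice P v = (Ξ ξ v).πn` (any partner datum `hSC`).
* §2 `evpRepOf_of_eventuallyEq_of_evpFin` — `(∀ᶠ v, clFinChoice P v = (F v).πn) → evpFin 𝔩 F Pg → evpRepOf 𝔩 P Pg`;
  `evpRep_of_routesAt_of_evp_piXiPrime` — routed + `evp (piXiPrime Ξ ξ) Pg` ⟹ `evpRep [P] Pg`; `evpRep_of_routesAt_of_evpFin_xiFamilyOfRecord` — the same from the
  F0P3 record string `evpFin 𝔩 (xiFamilyOfRecord … ξ) Pg` (★ S5 `eventually_clFinChoice_eq_recordπn_of_ae_routesAt`).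
* §3 `evpRep_of_ae_of_evp_piXiPrime` — **(AE) + «t(Π′(ξ)) = t(Pg)» ⟹ `evpRep [P] Pg`** at the record built from the SIGNED Q-package (`hSC := hSCD_of_cmCharIdentityPackageTestSigned
  … hQS`, ★) — the engine's `hevp` at the datum.

[cite: Rogawski1990, §14.6 p. 242, Thm. 14.6.4 p. 244; §13.1 p. 199; §13.3 p. 201; §13.7 p. 206; §14.2 p. 233; §12.2 (2) pp. 173–174] [cite: FlathCorvallis1979, Thm. 3]
[cite: CartierCorvallis1979, §IV.1 Cor. 4.1]
-/

set_option autoImplicit false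
-- the mandated namespace repeats `HodgeConjecture.HodgeConjecture`, as in every `Theorems/*.lean` of this sub-problem
set_option linter.dupNamespace false

noncomputable section

open NumberField IsDedekindDomain MeasureTheory Filter
open scoped Matrix ComplexOrder

open Literature.NumberTheory Literature.NumberTheory.Automorphic Literature.NumberTheory.Automorphic.UnitaryGroup
open Literature.NumberTheory.Automorphic.IdeleClassGroup
open Literature.NumberTheory.GaloisRepresentations
open Literature.NumberTheory.Rogawski1990

namespace Summit.HodgeConjecture.HodgeConjecture.R90.S9

open Summit.HodgeConjecture.HodgeConjecture.Cruxes.H413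
open Summit.HodgeConjecture.HodgeConjecture.Cruxes.H413.F0P3ClassTokenChoice (clFinChoice)
open Summit.HodgeConjecture.HodgeConjecture.Cruxes.H413.F0P3CohClassRoutingCot (RoutesAt)
open Summit.HodgeConjecture.HodgeConjecture.Cruxes.H413.F0P3GlobalPacket Summit.HodgeConjecture.HodgeConjecture.Cruxes.H413.F0P3LocalPacketKit
open Summit.HodgeConjecture.HodgeConjecture.Cruxes.H413.F0P3XiLocalFamilyOfRecord (xiFamilyOfRecord)
open Summit.HodgeConjecture.HodgeConjecture.Cruxes.H413.F0P3XiPacketFamilyOfRecordSCD (xiPacketFamilyOfRecordSCD xiPacketFamilyOfRecordSCD_of_split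
  xiPacketFamilyOfRecordSCD_of_nonsplit hSCD_of_cmCharIdentityPackageTestSigned)

/-! ## §1 Routed off a finite set ⟹ the chosen class IS the record's `πⁿ`-slot at almost every place -/

section Routed

variable (L : Type) [Field L] [NumberField L] [IsCMField L] (H : Matrix (Fin 3) (Fin 3) L)
    (hH : (H.map (cmConjRingHom L))ᵀ = H) (hHd : IsUnit H.det) (μω : HeckeCharacter L) (hμu : μω.IsUnitary)
    [∀ v : HeightOneSpectrum (𝓞 ↥(maximalRealSubfield L)), MeasurableSpace (Gqs L v ⧸ Subgroup.center (Gqs L v))]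
    (μZ : ∀ v : HeightOneSpectrum (𝓞 ↥(maximalRealSubfield L)), Measure (Gqs L v ⧸ Subgroup.center (Gqs L v)))
    (keys : ∀ (ξ : OneDimAutRepH L) (v : HeightOneSpectrum (𝓞 ↥(maximalRealSubfield L))),
      (∀ w : PlacesOver L v, IsCMField.complexConj L • w.1 = w.1) →
        {p : IrrClass (Gqs L v) × IrrClass (Gqs L v) //
          KeysCaseTwoLabels L v (μω.semilocalComponent L v) (torusLocalComponent L (IsCMField.complexConj L) v ξ.η)
            (torusLocalComponent L (IsCMField.complexConj L) v ξ.ψ) p.1 p.2 ∧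
          p.1.IsSquareIntegrable (μZ v) ∧ ¬ p.2.IsSquareIntegrable (μZ v)})
    (hSC : ∀ (ξ : OneDimAutRepH L) (v : HeightOneSpectrum (𝓞 ↥(maximalRealSubfield L)))
      (hns : ∀ w : PlacesOver L v, IsCMField.complexConj L • w.1 = w.1)
      (T : GL (Fin 3) (LocalRing L v)) (a : LocalRing L v) (ha : IsUnit a)
      (h : formCongr (conjLocal L (IsCMField.complexConj L) v) T (H.map (algebraMap L (LocalRing L v))) =
        a • (Matrix.of fun i j : Fin 3 => if i.val + j.val + 1 = 3 then (1 : L) else 0).map (algebraMap L (LocalRing L v)))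
      (π2 πn : IrrClass (Gqs L v)),
      KeysCaseTwoLabels L v (μω.semilocalComponent L v) (torusLocalComponent L (IsCMField.complexConj L) v ξ.η)
        (torusLocalComponent L (IsCMField.complexConj L) v ξ.ψ) π2 πn → ¬ πn.IsSquareIntegrable (μZ v) →
      {πs : IrrClass ((cmDatum L 3 H).Local v) // πs.IsSupercuspidal ∧ πs ≠ IrrClass.comap (cmDatumLocalCongr L v T ha h).symm πn})
    (μA : Measure (adelicGroupData (↥(maximalRealSubfield L)) L (IsCMField.complexConj L) 3 H).automorphicQuotient)
    [(adelicGroupData (↥(maximalRealSubfield L)) L (IsCMField.complexConj L) 3 H).IsAutomorphicMeasure μA]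

/-- **Routed off a finite set ⟹ `clFinChoice P v = (Ξ ξ v).πn` for almost all `v`**, `Ξ := xiPacketFamilyOfRecordSCD … μZ keys hSC` (any partner datum `hSC`).  At a split
`v ∉ S` both sides are the member of the D6 split packet at the fixed witness (★ `RoutesAt` (S), ★ `xiPacketFamilyOfRecordSCD_of_split`); at a non-split `v ∉ S` admitting a
level-matching frame (cofinitely many: ★ `eventually_exists_cmDatumLocalCongr_levelMatching_three`) the record frame `e₀` is level-matching (★ `_of_nonsplit`) and ★
`RoutesAt` (N) reads `clFinChoice P v = πⁿ ∘ e₀`. [cite: Rogawski1990, §13.1 p. 199; §12.2 (2) pp. 173–174; §14.2 p. 233; §13.3 p. 201] -/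
theorem eventually_clFinChoice_eq_πn_recordSCD_of_routesAt
    (P : DiscreteAutomorphicRep (adelicGroupData (↥(maximalRealSubfield L)) L (IsCMField.complexConj L) 3 H) μA) (ξ : OneDimAutRepH L)
    (S : Finset (HeightOneSpectrum (𝓞 ↥(maximalRealSubfield L))))
    (hroute : ∀ v : HeightOneSpectrum (𝓞 ↥(maximalRealSubfield L)), v ∉ S → RoutesAt L H hH hHd μω hμu μZ keys μA P ξ v) :
    ∀ᶠ v : HeightOneSpectrum (𝓞 ↥(maximalRealSubfield L)) in cofinite,
      clFinChoice P v = (xiPacketFamilyOfRecordSCD L H hH hHd μω hμu μZ keys hSC ξ v).πn := by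
  filter_upwards [S.eventually_cofinite_notMem, eventually_exists_cmDatumLocalCongr_levelMatching_three L H hH hHd] with v hv hLM
  by_cases hs : ∃ w : PlacesOver L v, IsCMField.complexConj L • w.1 ≠ w.1
  · rw [xiPacketFamilyOfRecordSCD_of_split L H hH hHd μω hμu μZ keys hSC ξ v hs]
    exact (hroute v hv).1 hs
  · have hns : ∀ w : PlacesOver L v, IsCMField.complexConj L • w.1 = w.1 := fun w => not_not.1 fun hw => hs ⟨w, hw⟩
    obtain ⟨T₀, a₀, ha₀, h₀, hΞ, hT₀⟩ := xiPacketFamilyOfRecordSCD_of_nonsplit L H hH hHd μω hμu μZ keys hSC ξ v hns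
    rw [hΞ]
    obtain ⟨T, a, ha, h, hT⟩ := hLM hns
    exact (hroute v hv).2 hns T₀ a₀ ha₀ h₀ (hT₀ ⟨T, a, ha, h, hT⟩)

end Routed

/-! ## §2 `evpFin (Ξ ξ) Pg ⟹ evpRepOf P Pg` along the a.e. equality; the two record spellings -/

section Evp

variable (L : Type) [Field L] [NumberField L] [IsCMField L] (H : Matrix (Fin 3) (Fin 3) L) {H' : Matrix (Fin 3) (Fin 3) L}
    (μA : Measure (adelicGroupData (↥(maximalRealSubfield L)) L (IsCMField.complexConj L) 3 H).automorphicQuotient)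
    [(adelicGroupData (↥(maximalRealSubfield L)) L (IsCMField.complexConj L) 3 H).IsAutomorphicMeasure μA]
    (𝔩 : ∀ v : HeightOneSpectrum (𝓞 ↥(maximalRealSubfield L)), LocalPacketKit L H' v)

/-- **`evpRepOf_of_eventuallyEq_of_evpFin`** — if the chosen classes of `P` ARE the `πⁿ`-slots of a family `F` almost everywhere, then «`t(F) = t(Pg)`» (★ `evpFin`: the
`πⁿ`-slots transport to the unramified members of `Pg` a.e.) gives «`t(P) = t(Pg)`» (★ `evpRepOf`).  A filter triviality. [cite: Rogawski1990, §14.6 p. 242; §13.7 p. 206] -/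
theorem evpRepOf_of_eventuallyEq_of_evpFin (P : DiscreteAutomorphicRep (adelicGroupData (↥(maximalRealSubfield L)) L (IsCMField.complexConj L) 3 H) μA)
    (F : InnerFormSec146.PacketPrimeFin L H) (Pg : GlobalPacket 𝔩)
    (hF : ∀ᶠ v : HeightOneSpectrum (𝓞 ↥(maximalRealSubfield L)) in cofinite, clFinChoice P v = (F v).πn)
    (hevp : InnerFormSec146.evpFin L H 𝔩 F Pg) : InnerFormSec146.evpRepOf L H μA 𝔩 P Pg := by
  unfold InnerFormSec146.evpRepOf
  unfold InnerFormSec146.evpFin at hevp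
  filter_upwards [hF, hevp] with v hv hT
  rw [hv]
  exact hT

variable (hH : (H.map (cmConjRingHom L))ᵀ = H) (hHd : IsUnit H.det) (μω : HeckeCharacter L) (hμu : μω.IsUnitary)
    [∀ v : HeightOneSpectrum (𝓞 ↥(maximalRealSubfield L)), MeasurableSpace (Gqs L v ⧸ Subgroup.center (Gqs L v))]
    (μZ : ∀ v : HeightOneSpectrum (𝓞 ↥(maximalRealSubfield L)), Measure (Gqs L v ⧸ Subgroup.center (Gqs L v)))
    (keys : ∀ (ξ : OneDimAutRepH L) (v : HeightOneSpectrum (𝓞 ↥(maximalRealSubfield L))),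
      (∀ w : PlacesOver L v, IsCMField.complexConj L • w.1 = w.1) →
        {p : IrrClass (Gqs L v) × IrrClass (Gqs L v) //
          KeysCaseTwoLabels L v (μω.semilocalComponent L v) (torusLocalComponent L (IsCMField.complexConj L) v ξ.η)
            (torusLocalComponent L (IsCMField.complexConj L) v ξ.ψ) p.1 p.2 ∧
          p.1.IsSquareIntegrable (μZ v) ∧ ¬ p.2.IsSquareIntegrable (μZ v)})
    (hSC : ∀ (ξ : OneDimAutRepH L) (v : HeightOneSpectrum (𝓞 ↥(maximalRealSubfield L)))
      (hns : ∀ w : PlacesOver L v, IsCMField.complexConj L • w.1 = w.1)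
      (T : GL (Fin 3) (LocalRing L v)) (a : LocalRing L v) (ha : IsUnit a)
      (h : formCongr (conjLocal L (IsCMField.complexConj L) v) T (H.map (algebraMap L (LocalRing L v))) =
        a • (Matrix.of fun i j : Fin 3 => if i.val + j.val + 1 = 3 then (1 : L) else 0).map (algebraMap L (LocalRing L v)))
      (π2 πn : IrrClass (Gqs L v)),
      KeysCaseTwoLabels L v (μω.semilocalComponent L v) (torusLocalComponent L (IsCMField.complexConj L) v ξ.η)
        (torusLocalComponent L (IsCMField.complexConj L) v ξ.ψ) π2 πn → ¬ πn.IsSquareIntegrable (μZ v) →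
      {πs : IrrClass ((cmDatum L 3 H).Local v) // πs.IsSupercuspidal ∧ πs ≠ IrrClass.comap (cmDatumLocalCongr L v T ha h).symm πn})

/-- **`evpRep_of_routesAt_of_evp_piXiPrime` — routed + «t(Π′(ξ)) = t(Pg)» ⟹ «t(P) = t(Pg)»** in (D)'s currency: with `Ξ := xiPacketFamilyOfRecordSCD … μZ keys hSC`, if `P` is
routed by `ξ` off a finite set and `evp (piXiPrime Ξ ξ) Pg` (= `Γ₀.evp (Π′(ξ)) Pg`), then `evpRep (classOf P) Pg` (= `Γ₀.evpRep [P] Pg`).  §1 + `evpRepOf_of_eventuallyEq_of_evpFin`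
+ ★ `evp_piXiPrime_iff` + ★ `evpRep_classOf`. [cite: Rogawski1990, §14.6 p. 242, Thm. 14.6.4 p. 244; §13.1 p. 199; §14.2 p. 233] -/
theorem evpRep_of_routesAt_of_evp_piXiPrime
    (P : DiscreteAutomorphicRep (adelicGroupData (↥(maximalRealSubfield L)) L (IsCMField.complexConj L) 3 H) μA) (ξ : OneDimAutRepH L)
    (S : Finset (HeightOneSpectrum (𝓞 ↥(maximalRealSubfield L))))
    (hroute : ∀ v : HeightOneSpectrum (𝓞 ↥(maximalRealSubfield L)), v ∉ S → RoutesAt L H hH hHd μω hμu μZ keys μA P ξ v) (Pg : GlobalPacket 𝔩)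
    (hevp : InnerFormSec146.evp L H μA (xiPacketFamilyOfRecordSCD L H hH hHd μω hμu μZ keys hSC) 𝔩
      (InnerFormSec146.piXiPrime L H μA (xiPacketFamilyOfRecordSCD L H hH hHd μω hμu μZ keys hSC) ξ) Pg) :
    InnerFormSec146.evpRep L H μA 𝔩 (InnerFormSec146.classOf L H μA P) Pg :=
  (InnerFormSec146.evpRep_classOf L H μA 𝔩 P Pg).2
    (evpRepOf_of_eventuallyEq_of_evpFin L H μA 𝔩 P _ Pg
      (eventually_clFinChoice_eq_πn_recordSCD_of_routesAt L H hH hHd μω hμu μZ keys hSC μA P ξ S hroute)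
      ((InnerFormSec146.evp_piXiPrime_iff L H μA _ 𝔩 ξ Pg).1 hevp))

/-- **`evpRep_of_routesAt_of_evpFin_xiFamilyOfRecord` — the same from the F0P3 record string**: routed + `evpFin 𝔩 (xiFamilyOfRecord … ξ) Pg` (the `πⁿ(ξ_v)`-string of ★
`F0P3XiLocalFamilyOfRecord`, the family named by the E1 string of ★ `aeString_of_ae`) ⟹ `evpRep (classOf P) Pg` — via ★ S5 `eventually_clFinChoice_eq_recordπn_of_ae_routesAt`
(Borel Haar measures `μZ v`). [cite: Rogawski1990, §14.6 p. 242; §13.6 p. 209; §13.3 p. 201] [cite: Macdonald1971, Ch. V §3] -/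
theorem evpRep_of_routesAt_of_evpFin_xiFamilyOfRecord
    [∀ v : HeightOneSpectrum (𝓞 ↥(maximalRealSubfield L)), BorelSpace (Gqs L v ⧸ Subgroup.center (Gqs L v))]
    [∀ v : HeightOneSpectrum (𝓞 ↥(maximalRealSubfield L)), (μZ v).IsHaarMeasure]
    (P : DiscreteAutomorphicRep (adelicGroupData (↥(maximalRealSubfield L)) L (IsCMField.complexConj L) 3 H) μA) (ξ : OneDimAutRepH L)
    (S : Finset (HeightOneSpectrum (𝓞 ↥(maximalRealSubfield L))))
    (hroute : ∀ v : HeightOneSpectrum (𝓞 ↥(maximalRealSubfield L)), v ∉ S → RoutesAt L H hH hHd μω hμu μZ keys μA P ξ v) (Pg : GlobalPacket 𝔩)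
    (hevp : InnerFormSec146.evpFin L H 𝔩 (xiFamilyOfRecord L H hH hHd μω hμu ξ) Pg) :
    InnerFormSec146.evpRep L H μA 𝔩 (InnerFormSec146.classOf L H μA P) Pg :=
  (InnerFormSec146.evpRep_classOf L H μA 𝔩 P Pg).2
    (evpRepOf_of_eventuallyEq_of_evpFin L H μA 𝔩 P _ Pg
      ((R90.S5.eventually_clFinChoice_eq_recordπn_of_ae_routesAt L H hH hHd μω hμu μZ keys μA P ξ S hroute).mono fun _ hv => hv.2) hevp)

end Evp

/-! ## §3 (AE) + «t(Π′(ξ)) = t(Pg)» ⟹ «t(P) = t(Pg)» — the engine's `hevp` at the record built from the SIGNED Q-package -/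

section AE

variable (L : Type) [Field L] [NumberField L] [IsCMField L] (H : Matrix (Fin 3) (Fin 3) L) {H' : Matrix (Fin 3) (Fin 3) L}
    (hH : (H.map (cmConjRingHom L))ᵀ = H) (hHd : IsUnit H.det)
    [∀ v : HeightOneSpectrum (𝓞 ↥(maximalRealSubfield L)), MeasurableSpace ((cmDatum L 3 H).Local v)]
    [∀ v : HeightOneSpectrum (𝓞 ↥(maximalRealSubfield L)),
      MeasurableSpace ((cmDatum L 2 (Matrix.of fun i j : Fin 2 => if i.val + j.val + 1 = 2 then (1 : L) else 0)).Local v ×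
        (cmDatum L 1 (Matrix.of fun i j : Fin 1 => if i.val + j.val + 1 = 1 then (1 : L) else 0)).Local v)]
    [∀ (v : HeightOneSpectrum (𝓞 ↥(maximalRealSubfield L)))
        (a : ((cmDatum L 2 (Matrix.of fun i j : Fin 2 => if i.val + j.val + 1 = 2 then (1 : L) else 0)).Local v ×
          (cmDatum L 1 (Matrix.of fun i j : Fin 1 => if i.val + j.val + 1 = 1 then (1 : L) else 0)).Local v)),
      MeasurableSpace (((cmDatum L 2 (Matrix.of fun i j : Fin 2 => if i.val + j.val + 1 = 2 then (1 : L) else 0)).Local v ×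
          (cmDatum L 1 (Matrix.of fun i j : Fin 1 => if i.val + j.val + 1 = 1 then (1 : L) else 0)).Local v) ⧸
        Subgroup.centralizer ({a} : Set ((cmDatum L 2 (Matrix.of fun i j : Fin 2 => if i.val + j.val + 1 = 2 then (1 : L) else 0)).Local v ×
          (cmDatum L 1 (Matrix.of fun i j : Fin 1 => if i.val + j.val + 1 = 1 then (1 : L) else 0)).Local v)))]
    [∀ (v : HeightOneSpectrum (𝓞 ↥(maximalRealSubfield L))) (γ : (cmDatum L 3 H).Local v),
      MeasurableSpace ((cmDatum L 3 H).Local v ⧸ Subgroup.centralizer ({γ} : Set ((cmDatum L 3 H).Local v)))]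
    (Δ : ∀ v : HeightOneSpectrum (𝓞 ↥(maximalRealSubfield L)), LocalTransferFactor L H v)
    (mH : ∀ v : HeightOneSpectrum (𝓞 ↥(maximalRealSubfield L)),
      OrbitalMeasureFamily ((cmDatum L 2 (Matrix.of fun i j : Fin 2 => if i.val + j.val + 1 = 2 then (1 : L) else 0)).Local v ×
        (cmDatum L 1 (Matrix.of fun i j : Fin 1 => if i.val + j.val + 1 = 1 then (1 : L) else 0)).Local v))
    (mG : ∀ v : HeightOneSpectrum (𝓞 ↥(maximalRealSubfield L)), OrbitalMeasureFamily ((cmDatum L 3 H).Local v))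
    (νG : ∀ v : HeightOneSpectrum (𝓞 ↥(maximalRealSubfield L)), Measure ((cmDatum L 3 H).Local v))
    (νH : ∀ v : HeightOneSpectrum (𝓞 ↥(maximalRealSubfield L)),
      Measure ((cmDatum L 2 (Matrix.of fun i j : Fin 2 => if i.val + j.val + 1 = 2 then (1 : L) else 0)).Local v ×
        (cmDatum L 1 (Matrix.of fun i j : Fin 1 => if i.val + j.val + 1 = 1 then (1 : L) else 0)).Local v))
    (μω : HeckeCharacter L) (hμu : μω.IsUnitary)
    (hQS : CMCharIdentityPackageTestSigned L H hH hHd νH νG μω hμu Δ mH mG)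
    -- the record's V6 data: Borel Haar measures on the `U(Φ₃)(L⁺_v)⧸Z` and Keys' labelled pairs
    [∀ v : HeightOneSpectrum (𝓞 ↥(maximalRealSubfield L)), MeasurableSpace (Gqs L v ⧸ Subgroup.center (Gqs L v))]
    [∀ v : HeightOneSpectrum (𝓞 ↥(maximalRealSubfield L)), BorelSpace (Gqs L v ⧸ Subgroup.center (Gqs L v))]
    (μZ : ∀ v : HeightOneSpectrum (𝓞 ↥(maximalRealSubfield L)), Measure (Gqs L v ⧸ Subgroup.center (Gqs L v)))
    [∀ v : HeightOneSpectrum (𝓞 ↥(maximalRealSubfield L)), (μZ v).IsHaarMeasure]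
    (keys : ∀ (ξ : OneDimAutRepH L) (v : HeightOneSpectrum (𝓞 ↥(maximalRealSubfield L))),
      (∀ w : PlacesOver L v, IsCMField.complexConj L • w.1 = w.1) →
        {p : IrrClass (Gqs L v) × IrrClass (Gqs L v) //
          KeysCaseTwoLabels L v (μω.semilocalComponent L v) (torusLocalComponent L (IsCMField.complexConj L) v ξ.η)
            (torusLocalComponent L (IsCMField.complexConj L) v ξ.ψ) p.1 p.2 ∧
          p.1.IsSquareIntegrable (μZ v) ∧ ¬ p.2.IsSquareIntegrable (μZ v)})
    (ξ : OneDimAutRepH L)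
    (μA : Measure (adelicGroupData (↥(maximalRealSubfield L)) L (IsCMField.complexConj L) 3 H).automorphicQuotient)
    [(adelicGroupData (↥(maximalRealSubfield L)) L (IsCMField.complexConj L) 3 H).IsAutomorphicMeasure μA]
    (P : DiscreteAutomorphicRep (adelicGroupData (↥(maximalRealSubfield L)) L (IsCMField.complexConj L) 3 H) μA)

open scoped Classical in
set_option synthInstance.maxHeartbeats 400000 in
set_option maxHeartbeats 8000000 in
/-- **`evpRep_of_ae_of_evp_piXiPrime` — THE ENGINE'S `hevp` AT THE DATUM, FROM (AE).**  With `Ξ := xiPacketFamilyOfRecordSCD … μZ keys (hSCD_of_cmCharIdentityPackageTestSigned …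
hQS)` (the A-packet family of record read off the SIGNED Q-package, ★): (AE) for `ξ` (the (AE) clause of ★ `definiteXiMembership_of_ch14`'s `hRig`, BYTE FOR BYTE) and «`t(Π′(ξ)) =
t(Pg)`» (`evp (piXiPrime Ξ ξ) Pg` — at the datum `Γ₀.evp (Γ₀.PiXi′ ξ …) Pξ`, the junction input `hevpXi`) give «`t(P) = t(Pg)`» (`evpRep (classOf P) Pg` = `Γ₀.evpRep [P] Pξ`).
★ `routesAt_of_ae` (AFA at the anisotropic `H`) + §2. [cite: Rogawski1990, §14.6 p. 242, Thm. 14.6.4 p. 244; §13.1 p. 199; §12.2 (2) pp. 173–174; §14.2 p. 233] [cite: FlathCorvallis1979, Thm. 3] -/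
theorem evpRep_of_ae_of_evp_piXiPrime
    (hanis : ∀ x : Fin 3 → L, Literature.AlgebraicGeometry.ShimuraVarieties.hermForm (cmConjRingHom L) H x x = 0 → x = 0)
    (hAE :
      (∃ S : Finset (HeightOneSpectrum (𝓞 ↥(maximalRealSubfield L))),
        (∀ v : HeightOneSpectrum (𝓞 ↥(maximalRealSubfield L)), v ∉ S →
          ∀ (hns : ∀ w : PlacesOver L v, IsCMField.complexConj L • w.1 = w.1)
            (T : GL (Fin 3) (LocalRing L v)) (a : LocalRing L v) (ha : IsUnit a)
            (h : formCongr (conjLocal L (IsCMField.complexConj L) v) T (H.map (algebraMap L (LocalRing L v))) =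
              a • (Matrix.of fun i j : Fin 3 => if i.val + j.val + 1 = 3 then (1 : L) else 0).map (algebraMap L (LocalRing L v))),
          ∀ [MeasurableSpace (Gqs L v ⧸ Subgroup.center (Gqs L v))] [BorelSpace (Gqs L v ⧸ Subgroup.center (Gqs L v))]
            (μZ : Measure (Gqs L v ⧸ Subgroup.center (Gqs L v))) [μZ.IsHaarMeasure],
          ∀ (π2 πn : IrrClass (Gqs L v)),
            KeysCaseTwoLabels L v (μω.semilocalComponent L v) (torusLocalComponent L (IsCMField.complexConj L) v ξ.η)
              (torusLocalComponent L (IsCMField.complexConj L) v ξ.ψ) π2 πn →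
            ¬ πn.IsSquareIntegrable μZ →
            ∀ c : IrrClass ((cmDatum L 3 H).Local v),
              (IrrClass.comap (localPiEquiv L (IsCMField.complexConj L) 3 H v) c).IsConstituentOf
                  (P.finRep.smoothPart.toRepresentation.comp (inclPlace (↥(maximalRealSubfield L)) L (IsCMField.complexConj L) 3 H v)) →
              c = IrrClass.comap (cmDatumLocalCongr L v T ha h).symm πn) ∧
        (∀ v : HeightOneSpectrum (𝓞 ↥(maximalRealSubfield L)), v ∉ S →
          ∀ (hs : ∃ w : PlacesOver L v, IsCMField.complexConj L • w.1 ≠ w.1),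
            ∀ c : IrrClass ((cmDatum L 3 H).Local v),
              (IrrClass.comap (localPiEquiv L (IsCMField.complexConj L) 3 H v) c).IsConstituentOf
                  (P.finRep.smoothPart.toRepresentation.comp (inclPlace (↥(maximalRealSubfield L)) L (IsCMField.complexConj L) 3 H v)) →
              c ∈ (cmSplitPacket L H hH hHd v (splitWitness v hs) (splitWitness_spec v hs) (ξ.splitν₀ μω (splitWitness v hs).1)
                (ξ.locψ (splitWitness v hs).1) (ξ.norm_splitν₀_apply hμu (splitWitness v hs).1)
                (ξ.continuous_splitν₀ μω (splitWitness v hs).1) (ξ.norm_locψ_apply (splitWitness v hs).1)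
                (ξ.continuous_locψ (splitWitness v hs).1)).members)))
    (𝔩 : ∀ v : HeightOneSpectrum (𝓞 ↥(maximalRealSubfield L)), LocalPacketKit L H' v) (Pg : GlobalPacket 𝔩)
    (hevpXi : InnerFormSec146.evp L H μA
      (xiPacketFamilyOfRecordSCD L H hH hHd μω hμu μZ keys (hSCD_of_cmCharIdentityPackageTestSigned L H hH hHd μω hμu Δ mH mG νG νH μZ hQS)) 𝔩
      (InnerFormSec146.piXiPrime L H μA
        (xiPacketFamilyOfRecordSCD L H hH hHd μω hμu μZ keys (hSCD_of_cmCharIdentityPackageTestSigned L H hH hHd μω hμu Δ mH mG νG νH μZ hQS)) ξ) Pg) :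
    InnerFormSec146.evpRep L H μA 𝔩 (InnerFormSec146.classOf L H μA P) Pg := by
  obtain ⟨S, hroute⟩ := routesAt_of_ae L H hH hHd hanis μω hμu μZ keys ξ μA P hAE
  exact evpRep_of_routesAt_of_evp_piXiPrime L H μA 𝔩 hH hHd μω hμu μZ keys _ P ξ S hroute Pg hevpXi

end AE

end Summit.HodgeConjecture.HodgeConjecture.R90.S9

end
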